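import Summits.Ventures.PackingBounds.Configurations.KissingConstructionA
import Summits.Ventures.PackingBounds.SphericalCodes.DimThreeThird

/-!
# `A(3, arccos 1/3) = 9`: the Tammes nine-point configuration, attained side

Framing: lottery ticket; floor = certified bounds/negative ranges. Venture `PackingBounds` (cell
`pub-packcert`, seat `pub-packcert-energy`) — attained side of the cell's `A(n, arccos 1/3)` table, row `n = 3`
(Conway–Sloane, *SPLAG* Ch. 9 Table 9.2: `A(3, arccos 1/3) = 9`).

The optimal nine-point packing on `S²` (Schütte–van der Waerden: minimal angle exactly `arccos 1/3`) is the tricapped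
trigonal prism with prism radius `2/3` and half-height `√5/3`: its Gram matrix is RATIONAL (cosines `1/3`, `−1/9`, `−1/2`,
`−2/3`, `−7/9`, `1`), so the configuration has a rational realisation — here `9` integer vectors of norm `36` in `ℤ⁶`
(`c9`: an `LDLᵀ` factorisation with `√3`, `√5` replaced by integer vectors `(1,1,1)`, `(2,1)`), spanning a `3`-dimensional
subspace cut out by `21` pairwise orthogonal integer normals of the cell's `ℤ²⁴` model (`nu9`). Kernel checks: norms,
`3⟨x,y⟩ ≤ 36` for all pairs, orthogonality; transfer (`exists_transfer_orthogonal`) gives **`A(3, arccos 1/3) ≥ 9`**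
(`exists_code_third_9`) and, with the cell's kernel-checked Delsarte bound `≤ 9`, the exact value (`code_dim3_third_exact`).

## References
* J. H. Conway, N. J. A. Sloane, *Sphere Packings, Lattices and Groups*, Ch. 9 Table 9.2; Ch. 1 §2.3 (Tammes problem). [`ConwaySloane1999`]
-/

namespace Summit.Ventures.PackingBounds.Config.CodeThird3

open Finset Leech Golay CL17

/-- Coordinates: entry `6 i + k` is the `k`-th coordinate of point `i` (caps `0–2`, prism vertices `3–8`; norm `36`). -/
def c9 (t : ℕ) : ℤ :=
  match t with
  | 0 => 6 | 1 => 0 | 2 => 0 | 3 => 0 | 4 => 0 | 5 => 0 | 6 => -3 | 7 => 3 | 8 => 3 | 9 => 3 | 10 => 0 | 11 => 0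
  | 12 => -3 | 13 => -3 | 14 => -3 | 15 => -3 | 16 => 0 | 17 => 0 | 18 => 2 | 19 => -2 | 20 => -2 | 21 => -2
  | 22 => 4 | 23 => 2 | 24 => 2 | 25 => -2 | 26 => -2 | 27 => -2 | 28 => -4 | 29 => -2 | 30 => 2 | 31 => 2 | 32 => 2
  | 33 => 2 | 34 => 4 | 35 => 2 | 36 => 2 | 37 => 2 | 38 => 2 | 39 => 2 | 40 => -4 | 41 => -2 | 42 => -4 | 43 => 0
  | 44 => 0 | 45 => 0 | 46 => 4 | 47 => 2 | 48 => -4 | 49 => 0 | 50 => 0 | 51 => 0 | 52 => -4 | 53 => -2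
  | _ => 0

/-- Point `i` in the `ℤ²⁴` model (first six coordinates). -/
def v9 (i : ℕ) : Fin 24 → ℤ := fun j => if j.val < 6 then c9 (6 * i + j.val) else 0

/-- The `21` integer normals: three cutting out the span of the points inside the first six coordinates
(`(0, 2, -1, -1, 0, 0)`, `(0, 0, 1, -1, 0, 0)`, `(0, 0, 0, 0, 1, -2)`) and `e₆, …, e₂₃`. -/
def nu9 (i : Fin 21) (j : Fin 24) : ℤ :=
  if i.val = 0 then (if j.val = 1 then 2 else if j.val = 2 then -1 else if j.val = 3 then -1 else 0)
  else if i.val = 1 then (if j.val = 2 then 1 else if j.val = 3 then -1 else 0)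
  else if i.val = 2 then (if j.val = 4 then 1 else if j.val = 5 then -2 else 0)
  else (if j.val = 3 + i.val then 1 else 0)

/-- Kernel check: norms `36`. -/
theorem v9_norm : ∀ i < 9, ip (v9 i) (v9 i) = 36 := by decide +kernel

/-- Kernel check: `3 ⟨x, y⟩ ≤ 36` for distinct points (cosine `≤ 1/3`). -/
theorem v9_pairs : ∀ i < 9, ∀ j < 9, i = j ∨ 3 * ip (v9 i) (v9 j) ≤ 36 := by decide +kernel

/-- Kernel facts on the normals: pairwise orthogonal, nonzero, orthogonal to the nine points. -/
theorem nu9_facts : (∀ i i' : Fin 21, i ≠ i' → ip (nu9 i) (nu9 i') = 0) ∧ (∀ i : Fin 21, ip (nu9 i) (nu9 i) ≠ 0) ∧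
    (∀ i : Fin 21, ∀ k < 9, ip (nu9 i) (v9 k) = 0) := by
  refine ⟨by decide +kernel, by decide +kernel, by decide +kernel⟩

/-- `v9` is injective on `range 9`. -/
theorem v9_injOn : Set.InjOn v9 (range 9 : Finset ℕ) := by
  intro i hi j hj h
  rw [mem_coe, mem_range] at hi hj
  rcases v9_pairs i hi j hj with e | e
  · exact e
  · rw [h, v9_norm j hj] at e; omega

/-- The normals as vectors of `ℝ²⁴`. -/
noncomputable def nrm9 (i : Fin 21) : EuclideanSpace ℝ (Fin 24) := toE 1 (nu9 i)

/-- The normals are linearly independent. -/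
theorem linearIndependent_nrm9 : LinearIndependent ℝ nrm9 := by
  obtain ⟨horth, hnz, -⟩ := nu9_facts
  apply linearIndependent_of_ne_zero_of_inner_eq_zero
  · intro i h
    have h1 : inner ℝ (nrm9 i) (nrm9 i) = 0 := by rw [h, inner_zero_left]
    rw [nrm9, inner_toE (by norm_num), div_eq_zero_iff] at h1
    rcases h1 with h1 | h1
    · exact hnz i (by exact_mod_cast h1)
    · norm_num at h1
  · intro i j hij
    rw [nrm9, nrm9, inner_toE (by norm_num), horth i j hij]
    simp

/-- **`A(3, arccos 1/3) ≥ 9`**: nine unit vectors of `ℝ³` with pairwise inner products `≤ 1/3`. [cite: ConwaySloane1999, Ch. 9 Table 9.2] -/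
theorem exists_code_third_9 : ∃ C : Finset (EuclideanSpace ℝ (Fin 3)),
    C.card = 9 ∧ (∀ x ∈ C, ‖x‖ = 1) ∧ (∀ x ∈ C, ∀ y ∈ C, x ≠ y → inner ℝ x y ≤ 1 / 3) := by
  set K := ((range 9).image v9).image (toE 36) with hK
  have hKc : K.card = 9 := by
    rw [hK, card_image_of_injective _ (toE_injective (by norm_num)), card_image_of_injOn v9_injOn, card_range]
  have hKn : ∀ p ∈ K, ‖p‖ = 1 := by
    intro p hp
    obtain ⟨x, hx, rfl⟩ := mem_image.mp hp
    obtain ⟨i, hi, rfl⟩ := mem_image.mp hx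
    exact norm_toE (by norm_num) (by rw [v9_norm i (mem_range.mp hi)]; norm_num)
  have hKi : ∀ p ∈ K, ∀ p' ∈ K, p ≠ p' → inner ℝ p p' ≤ 1 / 3 := by
    intro p hp p' hp' hne
    obtain ⟨x, hx, rfl⟩ := mem_image.mp hp
    obtain ⟨y, hy, rfl⟩ := mem_image.mp hp'
    obtain ⟨i, hi, rfl⟩ := mem_image.mp hx
    obtain ⟨j, hj, rfl⟩ := mem_image.mp hy
    have hij : i ≠ j := fun h => hne (by rw [h])
    rw [inner_toE (by norm_num), div_le_iff₀ (by norm_num)]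
    have h := (v9_pairs i (mem_range.mp hi) j (mem_range.mp hj)).resolve_left hij
    have h' : (3 * ip (v9 i) (v9 j) : ℝ) ≤ 36 := by exact_mod_cast h
    linarith
  have hKo : ∀ p ∈ K, ∀ i : Fin 21, inner ℝ (nrm9 i) p = 0 := by
    intro p hp i
    obtain ⟨x, hx, rfl⟩ := mem_image.mp hp
    obtain ⟨k, hk, rfl⟩ := mem_image.mp hx
    rw [nrm9, inner_toE_toE (by norm_num) (by norm_num), nu9_facts.2.2 i k (mem_range.mp hk)]
    simp
  obtain ⟨C', hc, hno, hi, _⟩ := exists_transfer_orthogonal (m := 24) (n := 3) (k := 21) (by norm_num)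
    nrm9 linearIndependent_nrm9 K hKo
  refine ⟨C', by rw [hc, hKc], fun x' hx' => ?_, fun x' hx' y' hy' hne => ?_⟩
  · obtain ⟨x, hx, he⟩ := hno x' hx'
    rw [he]; exact hKn x hx
  · obtain ⟨x, hx, y, hy, hxy, he⟩ := hi x' hx' y' hy' hne
    rw [he]; exact hKi x hx y hy hxy

/-- **`A(3, arccos 1/3) = 9` in Lean**: nine points are attained (Tammes configuration) and the cell's kernel-checked Delsarte
bound excludes ten. [cite: ConwaySloane1999, Ch. 9 Table 9.2] -/
theorem code_dim3_third_exact :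
    IsGreatest {N : ℕ | ∃ C : Finset (EuclideanSpace ℝ (Fin 3)), C.card = N ∧ (∀ x ∈ C, ‖x‖ = 1) ∧
      (∀ x ∈ C, ∀ y ∈ C, x ≠ y → inner ℝ x y ≤ 1 / 3)} 9 := by
  refine ⟨exists_code_third_9, ?_⟩
  rintro N ⟨C, rfl, h1, h2⟩
  exact SphericalCodes.code_dim3_third_le_9 C h1 h2

end Summit.Ventures.PackingBounds.Config.CodeThird3
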